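import Mathlib
import HarnessLib
import Summits.HubbardSuperconductivity.HubbardSuperconductivity.Theorems.KLProgrammeKLRegimeEngineTowerBlockZeroWt
import Summits.HubbardSuperconductivity.HubbardSuperconductivity.Theorems.KLProgrammeKLRegimeEngineTowerBlockIncrLevKit
import Summits.HubbardSuperconductivity.HubbardSuperconductivity.Theorems.KLProgrammeKLRegimeEngineTowerBlockIncrWtFull

/-!
# Route `KLProgramme` — crux K3 ENGINE (stmt-HubbardSuperconductivity-20437 `KLRegimeEngineV17F2`), stub (b) v2, THE LEVELS PACKAGE (ℓ):
# instantiation (I1), BLOCK `0`, weighted ALL-KNOWN track — the single-tuple weighted pinned sums of `Δ_0` and the born array `klTowerBornWtFull … d 0` in kit form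
# (E1-LEVELS-BLUEPRINT v5 §1 (β); continuation of `…TowerBlockZeroWt` (weighted pinned track); cell gate-hubbard-kl, seat hubbard-kl-k3c2-p3 g12 as SUBSTITUTE typer
#  while the E1 lineage is unseated — E1 may rename or supersede)

As in `…TowerBlockZeroWt`, block `0`'s increment `Δ_0 = 𝒱_d − 𝒱_0` is ONE Gaussian step `C^K_{(Λ_d, Λ_0]}` from the scale-`0` action read in the TRIVIAL family; here
the output legs are PRESCRIBED (the all-known currency of `klTowerBornWtFull`, p624466).  The prescribed doors need a child relation and a parents count: with the
trivial input family the child relation is support overlap (`overlap_of_sectorAnalysis_mul_sectorSub_ne_zero`) and EVERY fine label has at most ONE parent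
(`card_parents_trivialMultiplier_le_one`: the input label set `SectorLeg 1` has one sector per spin/charge), so `ρc = 1`:

* §1 `card_parents_trivialMultiplier_le_one`;
* §2 **`pinnedTupleWtSum_klTowerIncr_zero_le_kit`** — for `Z^K_{Λ_0} ≠ 0`, the block-`0` constants at the trivial family (Gram `κ`, weighted `α`, weighted overlap
  `(cr, cc)` of `E(F_{J′})·S(1)`, `ρ`), WEIGHTED PRESCRIBED plain input sizes `B m′ Fc` of `𝒱_0` with a track-blind majorant `N` (`ε·B m c ≤ N m`, `N 0 = 0`), kit
  parameters `τ, ψ` and the kit guard: for every pinned leg `i`, label tuple `σ′`, pin `y`, output family `F_{J′}`: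
  `ε^{2q+1}·Σ_{x′ i = y} klScaleWt_{J′}(pos x′)·‖W^{F_{J′}}_{σ′}(Δ_0)(x′)‖ ≤ ε^{2q+1}·(cr·cc^{2q+1}·(Σ e·Φ^{n−1}·ψ^{q+1}·towerS + ψ^{q+1}·tail) + cr·cc^{2q+1}·((e²)^{q+2}/2·towerFO))`
  (prescribed doors at the trivial family ∘ `sum_filter_prescribedAll_eq_pinnedTuple` ∘ the prescribed dictionary with `Jt := ↥(univ.erase i)` and the literal
  `J`-form `doorBinomialPrescribedJ_le_towerFO` — no pin-free detour);
* §3 **`klTowerBornWtFull_zero_le_kit`** — the carrier row at the born family `F_0` (`ciSup`).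
Compositions of landed theorems; nothing about the model is asserted beyond them; nothing asserts (ℓ), any stub, K3 or superconductivity.
References: BGM 2006 §2.7 (2.70)–(2.71a), §2.8 (2.76)–(2.84), (2.88)–(2.90), §3 (3.2)–(3.8) [cite: BenfattoGiulianiMastropietro2006].
-/

noncomputable section

namespace Summit.HubbardSuperconductivity.HubbardSuperconductivity.Theorems.EngineV8

set_option linter.dupNamespace false -- summit = problem name (single-conjunct summit), D-0017

open Classical
open Real Finset Literature.MathematicalPhysics.QuantumLattice Literature.Probability.LatticeModels GrassmannAlgebra
open Summit.HubbardSuperconductivity.HubbardSuperconductivity.Theorems.KLProgrammeLegKernels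
open Summit.HubbardSuperconductivity.HubbardSuperconductivity.Theorems.KLRegimeSplit
open Summit.HubbardSuperconductivity.HubbardSuperconductivity.Theorems.KLRegimeWick
open Summit.HubbardSuperconductivity.HubbardSuperconductivity.Theorems.TwoPointAssembly
open Literature.Probability.LatticeModels.BattleFederbush
open scoped Nat

variable {L M : ℕ}

/-! ## §1 One parent per fine label in the trivial family -/

/-- **In the trivial one-sector family every fine label has at most ONE parent** with the same spin and charge (whatever the child relation). -/
theorem card_parents_trivialMultiplier_le_one {N' : ℕ} (child : Fin N' → Fin 1 → Prop) (ℓ'' : SectorLeg N') :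
    (((univ.filter fun ℓ' : SectorLeg 1 => child ℓ''.1.1 ℓ'.1.1 ∧ ℓ'.1.2 = ℓ''.1.2 ∧ ℓ'.2 = ℓ''.2).card : ℕ) : ℝ) ≤ 1 := by
  have h : (univ.filter fun ℓ' : SectorLeg 1 => child ℓ''.1.1 ℓ'.1.1 ∧ ℓ'.1.2 = ℓ''.1.2 ∧ ℓ'.2 = ℓ''.2).card ≤ 1 := by
    refine card_le_one.2 fun a ha b hb => ?_
    simp only [mem_filter, mem_univ, true_and] at ha hb
    refine Prod.ext (Prod.ext (Subsingleton.elim _ _) (ha.2.1.trans hb.2.1.symm)) (ha.2.2.trans hb.2.2.symm)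
  exact_mod_cast h

/-! ## §2 The single-tuple weighted pinned sums of `Δ_0` in kit form -/

section Born

variable [NeZero L] [NeZero M]

/-- **BLOCK `0`, WEIGHTED ALL-KNOWN SIZES IN KIT FORM.**  `Z^K_{Λ_0} ≠ 0`; block-`0` constants at the trivial input family (Gram `κ`, weighted `α` of
`S(1)ᵀC^K_{(Λ_d,Λ_0]}S(1)`, weighted overlap `(cr, cc)` of `E(F_{J′})·S(1)`, radius `ρ`, truncation `N₀ ≥ 2`); WEIGHTED PRESCRIBED plain input sizes `B m′ Fc` of `𝒱_0`
(weight `klScaleWt L M β J′`, leg maps `latticeLegPos`) with a track-blind majorant `N ≥ 0`, `N 0 = 0`, `ε·B m c ≤ N m`; degree cap `D`; kit parameters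
`τ ≥ (e³κ)², (e²(κ+ρ))²`, `ψ ≥ κ⁻², ρ⁻²`; KIT guard.  Then for every `i, σ′, y`:
`ε^{2q+1}·Σ_{x′ i = y} klScaleWt_{J′}(pos x′)·‖W^{F_{J′}}_{σ′}(Δ_0)(x′)‖ ≤ ε^{2q+1}·(cr·cc^{2q+1}·(Σ + tail) + cr·cc^{2q+1}·((e²)^{q+2}/2·towerFO D κ² N (q+1)))`. -/
theorem pinnedTupleWtSum_klTowerIncr_zero_le_kit {β : ℝ} (hβ : 0 < β) (U μ : ℝ) (K : TrigPolyC4v) (d J' : ℕ)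
    (hZ : hubbardEffPartitionFnCT L M β U μ 0 K (klScale klE0 0) ≠ 0)
    {κ : ℝ} (hκ : 0 < κ)
    (hGB : IsGramBoundedR ((sectorSubMatrix L M β (trivialMultiplier L M)).transpose *
      hubbardCovSliceCT L M β μ 0 K (klScale klE0 d) (klScale klE0 0) * sectorSubMatrix L M β (trivialMultiplier L M)) κ)
    (B : ℕ → ℕ → ℝ) (hB0 : ∀ m' Fc, 0 ≤ B m' Fc)
    (hB : ∀ (m' Fc : ℕ) (E : Finset (Fin (2 * m' + 1 + 1))) (τ' : Fin (2 * m' + 1 + 1) → SectorLeg 1)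
      (q : Fin (2 * m' + 1 + 1)), q ∈ E → E.card = Fc + 1 → ∀ y : SpaceTimeIdx L M,
        imagTimeWeight β M ^ (2 * m' + 1) *
          ∑ σ ∈ univ.filter (fun σ : Fin (2 * m' + 1 + 1) → SectorLeg 1 => ∀ e ∈ E, σ e = τ' e),
            ∑ x ∈ univ.filter (fun x : Fin (2 * m' + 1 + 1) → SpaceTimeIdx L M => x q = y),
              klScaleWt L M β J' ((univ.image fun i => (x i, σ i)).image (latticeLegPos (2 * (2 * M)))) *
                ‖sectorisedKernel L M β (trivialMultiplier L M) (klEffectiveAction L M β U μ K klE0 0) (2 * m' + 1 + 1) σ x‖ ≤ B (m' + 1) Fc)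
    {α : ℝ} (hα : 0 < α)
    (hrow : ∀ X, ∑ Y, ‖((sectorSubMatrix L M β (trivialMultiplier L M)).transpose *
        hubbardCovSliceCT L M β μ 0 K (klScale klE0 d) (klScale klE0 0) * sectorSubMatrix L M β (trivialMultiplier L M)) X Y‖ *
        klScaleWt L M β J' {latticeLegPos (2 * (2 * M)) X, latticeLegPos (2 * (2 * M)) Y} ≤ α)
    (hcol : ∀ Y, ∑ X, ‖((sectorSubMatrix L M β (trivialMultiplier L M)).transpose *
        hubbardCovSliceCT L M β μ 0 K (klScale klE0 d) (klScale klE0 0) * sectorSubMatrix L M β (trivialMultiplier L M)) X Y‖ *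
        klScaleWt L M β J' {latticeLegPos (2 * (2 * M)) X, latticeLegPos (2 * (2 * M)) Y} ≤ α)
    {ρ : ℝ} (hρ : 0 < ρ)
    {cr cc : ℝ} (hcr0 : 0 ≤ cr) (hcc0 : 0 ≤ cc)
    (hrow' : ∀ X'', ∑ X', ‖(sectorAnalysisMatrix L M β (klAnisoFamily L M β μ K klE0 J') *
        sectorSubMatrix L M β (trivialMultiplier L M)) X'' X'‖ *
        klScaleWt L M β J' {latticeLegPos (2 * (2 * M)) X'', latticeLegPos (2 * (2 * M)) X'} ≤ cr)
    (hcol' : ∀ X', ∑ X'', ‖(sectorAnalysisMatrix L M β (klAnisoFamily L M β μ K klE0 J') *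
        sectorSubMatrix L M β (trivialMultiplier L M)) X'' X'‖ *
        klScaleWt L M β J' {latticeLegPos (2 * (2 * M)) X'', latticeLegPos (2 * (2 * M)) X'} ≤ cc)
    {N₀ : ℕ} (hN₀ : 2 ≤ N₀)
    {N : ℕ → ℝ} (hN0 : ∀ m, 0 ≤ N m) (hN00 : N 0 = 0) (hNB : ∀ m c, (1 : ℝ) ^ c * (imagTimeWeight β M * B m c) ≤ N m)
    {D : ℕ} (hD : Fintype.card (SpaceTimeIdx L M × SectorLeg 1) / 2 ≤ D)
    {τ ψ : ℝ} (hτ1 : (exp 3 * κ) ^ 2 ≤ τ) (hτ2 : (exp 2 * (κ + ρ)) ^ 2 ≤ τ) (hψ1 : κ⁻¹ ^ 2 ≤ ψ) (hψ2 : ρ⁻¹ ^ 2 ≤ ψ)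
    (hguard : exp 1 * α / κ ^ 2 * towerV D τ N < 1)
    (q : ℕ) (i : Fin (2 * q + 1 + 1)) (σ' : Fin (2 * q + 1 + 1) → SectorLeg (sectorCount J')) (y : SpaceTimeIdx L M) :
    imagTimeWeight β M ^ (2 * q + 1) *
        ∑ x' ∈ univ.filter (fun x' : Fin (2 * q + 1 + 1) → SpaceTimeIdx L M => x' i = y),
          klScaleWt L M β J' ((univ.image x').image (fun x : SpaceTimeIdx L M => (((((2 * (x.1 : ℕ) : ℕ)) : ZMod (2 * (2 * M)))), x.2))) *
            ‖sectorisedKernel L M β (klAnisoFamily L M β μ K klE0 J') (klTowerIncr L M β U μ K d 0) (2 * q + 1 + 1) σ' x'‖ ≤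
      imagTimeWeight β M ^ (2 * q + 1) *
        (cr * cc ^ (2 * q + 1) *
            (∑ n ∈ Icc 2 (N₀ - 1), exp 1 * (exp 1 * α / κ ^ 2) ^ (n - 1) * ψ ^ (q + 1) * towerS D τ N n (q + 1) +
              ψ ^ (q + 1) * (exp 1 * towerV D τ N * (exp 1 * α / κ ^ 2 * towerV D τ N) ^ (N₀ - 1) / (1 - exp 1 * α / κ ^ 2 * towerV D τ N))) +
          cr * cc ^ (2 * q + 1) * (exp 2 ^ (q + 2) / 2 * towerFO D (κ ^ 2) N (q + 1))) := by
  have hβ' : β ≠ 0 := hβ.ne'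
  have hε : 0 ≤ imagTimeWeight β M := imagTimeWeight_nonneg hβ.le M
  have h10 : (0 : ℝ) ≤ 1 := zero_le_one
  have hwt := isTreeWeight_klScaleWt L M hβ.le J'
  have hG : klEffectiveAction L M β U μ K klE0 0 ∈ evenPart ℂ (HubbardFieldIdx L M) := klEffectiveAction_mem_evenPart hβ' U μ K klE0 0
  have hG0 : constPart ℂ (klEffectiveAction L M β U μ K klE0 0) = 0 := constPart_klEffectiveAction_eq_zero β U μ K klE0 0 hZ
  have hi : i ∉ (univ.erase i : Finset (Fin (2 * q + 1 + 1))) := fun h => (mem_erase.1 h).1 rfl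
  -- `Δ_0` as one Gaussian step from `𝒱_0`
  have hZ' : hubbardEffPartitionFnCT L M β U μ 0 K (klScale klE0 (d * 0)) ≠ 0 := by rwa [Nat.mul_zero]
  have hΔ := klTowerIncr_eq_ordersGe2_add_firstOrder β U μ K d 0 hZ'
  simp only [Nat.mul_zero, zero_add, mul_one, klTowerInput] at hΔ
  -- the door guard from the kit guard
  have hV := normV_prescribed_le_towerV (Γ := SpaceTimeIdx L M × SectorLeg 1) (ρc := (1 : ℝ)) (ε := imagTimeWeight β M)
    hκ.le hρ.le (B := B) hN0 hN00 hNB hD hτ2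
  have hΦ0 : 0 ≤ exp 1 * α / κ ^ 2 := by positivity
  have hθ : Real.exp 1 * α * normV (SpaceTimeIdx L M × SectorLeg 1) κ ρ (fun m' => (1 : ℝ) ^ 0 * (imagTimeWeight β M * B m' 0)) / κ ^ 2 < 1 := by
    calc Real.exp 1 * α * normV (SpaceTimeIdx L M × SectorLeg 1) κ ρ (fun m' => (1 : ℝ) ^ 0 * (imagTimeWeight β M * B m' 0)) / κ ^ 2
        = exp 1 * α / κ ^ 2 * normV (SpaceTimeIdx L M × SectorLeg 1) κ ρ (fun m' => (1 : ℝ) ^ 0 * (imagTimeWeight β M * B m' 0)) := by ring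
      _ ≤ exp 1 * α / κ ^ 2 * towerV D τ N := mul_le_mul_of_nonneg_left hV hΦ0
      _ < 1 := hguard
  -- the two prescribed doors at the trivial input family, output legs `univ.erase i` prescribed to `σ′`, pin `(y, σ′ i)`
  have h2 := sum_filter_wt_norm_sectorAnalysis_effAction_sub_gaussConv_le_graded_prescribed_of_plateau hwt (latticeLegPos (2 * (2 * M)))
    (latticeLegPos (2 * (2 * M))) hβ (trivialMultiplier L M) (trivialMultiplier L M) trivialMultiplier_mul_self trivialMultiplier_eq_zero_of_sum_eq_zero
    (klAnisoFamily L M β μ K klE0 J') (klEffectiveAction L M β U μ K klE0 0) hG hG0 _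
    (sum_trivialMultiplier_eq_one_of_ne_zero (hubbardCovSliceCT L M β μ 0 K (klScale klE0 d) (klScale klE0 0)))
    (sum_trivialMultiplier_eq_one_of_family_ne_zero (klAnisoFamily L M β μ K klE0 J'))
    (fun ω'' ω' => ∃ p : FreqMomentum L M, klAnisoFamily L M β μ K klE0 J' ω'' p ≠ 0 ∧ trivialMultiplier L M ω' p ≠ 0)
    (fun X'' X' hne => overlap_of_sectorAnalysis_mul_sectorSub_ne_zero β _ _ X'' X' hne)
    h10 (fun ℓ'' => by
      convert card_parents_trivialMultiplier_le_one
        (fun ω'' ω' => ∃ p : FreqMomentum L M, klAnisoFamily L M β μ K klE0 J' ω'' p ≠ 0 ∧ trivialMultiplier L M ω' p ≠ 0) ℓ'' using 4)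
    hκ hGB B hB0 hB hα hrow hcol hρ hθ hcc0 hrow' hcol' hN₀ i (univ.erase i) hi σ' (y, σ' i)
  have h1 := sum_filter_wt_norm_sectorAnalysis_gaussConv_sub_le_binomial_prescribed_of_plateau hwt (latticeLegPos (2 * (2 * M)))
    (latticeLegPos (2 * (2 * M))) hβ (trivialMultiplier L M) (trivialMultiplier L M) trivialMultiplier_mul_self trivialMultiplier_eq_zero_of_sum_eq_zero
    (klAnisoFamily L M β μ K klE0 J') (klEffectiveAction L M β U μ K klE0 0) hG _
    (sum_trivialMultiplier_eq_one_of_ne_zero (hubbardCovSliceCT L M β μ 0 K (klScale klE0 d) (klScale klE0 0)))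
    (sum_trivialMultiplier_eq_one_of_family_ne_zero (klAnisoFamily L M β μ K klE0 J'))
    (fun ω'' ω' => ∃ p : FreqMomentum L M, klAnisoFamily L M β μ K klE0 J' ω'' p ≠ 0 ∧ trivialMultiplier L M ω' p ≠ 0)
    (fun X'' X' hne => overlap_of_sectorAnalysis_mul_sectorSub_ne_zero β _ _ X'' X' hne)
    h10 (fun ℓ'' => by
      convert card_parents_trivialMultiplier_le_one
        (fun ω'' ω' => ∃ p : FreqMomentum L M, klAnisoFamily L M β μ K klE0 J' ω'' p ≠ 0 ∧ trivialMultiplier L M ω' p ≠ 0) ℓ'' using 4)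
    hκ.le hGB B hB0 hB hcc0 hrow' hcol' i (univ.erase i) hi σ' (y, σ' i)
  -- relabel to the carrier's single-tuple form
  rw [sum_filter_prescribedAll_eq_pinnedTuple] at h2 h1
  -- dominate the brackets by the kit terms
  have hgr := doorGradedPrescribed_le_kitStep (Γ := SpaceTimeIdx L M × SectorLeg 1) (Jt := ↥(univ.erase i : Finset (Fin (2 * q + 1 + 1))))
    hκ hρ hα.le h10 hε hB0 hN0 hN00 hNB hD hN₀ (m := 2 * q + 1) (p := q + 1) (by ring) hτ1 hτ2 hψ1 hψ2 hguard
  rw [Fintype.card_coe] at hgr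
  have hfo := doorBinomialPrescribedJ_le_towerFO (κ := κ) (ρc := (1 : ℝ)) (ε := imagTimeWeight β M) hκ.le h10 hε hB0 (N := N) hNB hD q (univ.erase i)
  have h2' := h2.trans (mul_le_mul_of_nonneg_left hgr (by positivity))
  have h1' := h1.trans (mul_le_mul_of_nonneg_left hfo (by positivity))
  -- split `Δ_0`
  refine mul_le_mul_of_nonneg_left ?_ (pow_nonneg hε _)
  rw [hΔ]
  refine le_trans (sum_le_sum fun x' _ => ?_) (le_trans (le_of_eq (sum_add_distrib (s := univ.filter
    (fun x' : Fin (2 * q + 1 + 1) → SpaceTimeIdx L M => x' i = y)))) (add_le_add h2' h1'))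
  rw [← mul_add, sectorisedKernel_add, Pi.add_apply, Pi.add_apply]
  exact mul_le_mul_of_nonneg_left (norm_add_le _ _) (zero_le_one.trans (one_le_klScaleWt L M β J' _))

/-! ## §3 The carrier row at the born family `F_0` -/

/-- **BLOCK `0`'S WEIGHTED ALL-KNOWN BORN ARRAY IN KIT FORM** (`J′ = 0`, weight rate `0`): `klTowerBornWtFull … d 0 (2(q+1)) ≤ ε^{2q+1}·(cr·cc^{2q+1}·(Σ + tail) +
cr·cc^{2q+1}·((e²)^{q+2}/2·towerFO D κ² N (q+1)))` — the `k = 0` complement of `klTowerBornWtFull_le_kit` (p642483). -/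
theorem klTowerBornWtFull_zero_le_kit {β : ℝ} (hβ : 0 < β) (U μ : ℝ) (K : TrigPolyC4v) (d : ℕ)
    (hZ : hubbardEffPartitionFnCT L M β U μ 0 K (klScale klE0 0) ≠ 0)
    {κ : ℝ} (hκ : 0 < κ)
    (hGB : IsGramBoundedR ((sectorSubMatrix L M β (trivialMultiplier L M)).transpose *
      hubbardCovSliceCT L M β μ 0 K (klScale klE0 d) (klScale klE0 0) * sectorSubMatrix L M β (trivialMultiplier L M)) κ)
    (B : ℕ → ℕ → ℝ) (hB0 : ∀ m' Fc, 0 ≤ B m' Fc)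
    (hB : ∀ (m' Fc : ℕ) (E : Finset (Fin (2 * m' + 1 + 1))) (τ' : Fin (2 * m' + 1 + 1) → SectorLeg 1)
      (q : Fin (2 * m' + 1 + 1)), q ∈ E → E.card = Fc + 1 → ∀ y : SpaceTimeIdx L M,
        imagTimeWeight β M ^ (2 * m' + 1) *
          ∑ σ ∈ univ.filter (fun σ : Fin (2 * m' + 1 + 1) → SectorLeg 1 => ∀ e ∈ E, σ e = τ' e),
            ∑ x ∈ univ.filter (fun x : Fin (2 * m' + 1 + 1) → SpaceTimeIdx L M => x q = y),
              klScaleWt L M β 0 ((univ.image fun i => (x i, σ i)).image (latticeLegPos (2 * (2 * M)))) *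
                ‖sectorisedKernel L M β (trivialMultiplier L M) (klEffectiveAction L M β U μ K klE0 0) (2 * m' + 1 + 1) σ x‖ ≤ B (m' + 1) Fc)
    {α : ℝ} (hα : 0 < α)
    (hrow : ∀ X, ∑ Y, ‖((sectorSubMatrix L M β (trivialMultiplier L M)).transpose *
        hubbardCovSliceCT L M β μ 0 K (klScale klE0 d) (klScale klE0 0) * sectorSubMatrix L M β (trivialMultiplier L M)) X Y‖ *
        klScaleWt L M β 0 {latticeLegPos (2 * (2 * M)) X, latticeLegPos (2 * (2 * M)) Y} ≤ α)
    (hcol : ∀ Y, ∑ X, ‖((sectorSubMatrix L M β (trivialMultiplier L M)).transpose *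
        hubbardCovSliceCT L M β μ 0 K (klScale klE0 d) (klScale klE0 0) * sectorSubMatrix L M β (trivialMultiplier L M)) X Y‖ *
        klScaleWt L M β 0 {latticeLegPos (2 * (2 * M)) X, latticeLegPos (2 * (2 * M)) Y} ≤ α)
    {ρ : ℝ} (hρ : 0 < ρ)
    {cr cc : ℝ} (hcr0 : 0 ≤ cr) (hcc0 : 0 ≤ cc)
    (hrow' : ∀ X'', ∑ X', ‖(sectorAnalysisMatrix L M β (klAnisoFamily L M β μ K klE0 0) *
        sectorSubMatrix L M β (trivialMultiplier L M)) X'' X'‖ *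
        klScaleWt L M β 0 {latticeLegPos (2 * (2 * M)) X'', latticeLegPos (2 * (2 * M)) X'} ≤ cr)
    (hcol' : ∀ X', ∑ X'', ‖(sectorAnalysisMatrix L M β (klAnisoFamily L M β μ K klE0 0) *
        sectorSubMatrix L M β (trivialMultiplier L M)) X'' X'‖ *
        klScaleWt L M β 0 {latticeLegPos (2 * (2 * M)) X'', latticeLegPos (2 * (2 * M)) X'} ≤ cc)
    {N₀ : ℕ} (hN₀ : 2 ≤ N₀)
    {N : ℕ → ℝ} (hN0 : ∀ m, 0 ≤ N m) (hN00 : N 0 = 0) (hNB : ∀ m c, (1 : ℝ) ^ c * (imagTimeWeight β M * B m c) ≤ N m)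
    {D : ℕ} (hD : Fintype.card (SpaceTimeIdx L M × SectorLeg 1) / 2 ≤ D)
    {τ ψ : ℝ} (hτ1 : (exp 3 * κ) ^ 2 ≤ τ) (hτ2 : (exp 2 * (κ + ρ)) ^ 2 ≤ τ) (hψ1 : κ⁻¹ ^ 2 ≤ ψ) (hψ2 : ρ⁻¹ ^ 2 ≤ ψ)
    (hguard : exp 1 * α / κ ^ 2 * towerV D τ N < 1) (q : ℕ) :
    klTowerBornWtFull L M β U μ K d 0 (2 * (q + 1)) ≤
      imagTimeWeight β M ^ (2 * q + 1) *
        (cr * cc ^ (2 * q + 1) *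
            (∑ n ∈ Icc 2 (N₀ - 1), exp 1 * (exp 1 * α / κ ^ 2) ^ (n - 1) * ψ ^ (q + 1) * towerS D τ N n (q + 1) +
              ψ ^ (q + 1) * (exp 1 * towerV D τ N * (exp 1 * α / κ ^ 2 * towerV D τ N) ^ (N₀ - 1) / (1 - exp 1 * α / κ ^ 2 * towerV D τ N))) +
          cr * cc ^ (2 * q + 1) * (exp 2 ^ (q + 2) / 2 * towerFO D (κ ^ 2) N (q + 1))) := by
  have hε : 0 ≤ imagTimeWeight β M := imagTimeWeight_nonneg hβ.le M
  haveI : NeZero (sectorCount (d * 0)) := ⟨(sectorCount_pos _).ne'⟩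
  haveI : Nonempty (Fin (2 * (q + 1)) × (Fin (2 * (q + 1)) → SectorLeg (sectorCount (d * 0))) × SpaceTimeIdx L M) :=
    ⟨(⟨0, by omega⟩, fun _ => ((0, 0), 0), Classical.arbitrary _)⟩
  unfold klTowerBornWtFull
  refine ciSup_le fun t => ?_
  rw [show 2 * (q + 1) - 1 = 2 * q + 1 by omega]
  exact pinnedTupleWtSum_klTowerIncr_zero_le_kit (L := L) (M := M) hβ U μ K d (d * 0) hZ hκ hGB B hB0
    (by simpa only [Nat.mul_zero] using hB) hα (by simpa only [Nat.mul_zero] using hrow) (by simpa only [Nat.mul_zero] using hcol) hρ hcr0 hcc0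
    (by simpa only [Nat.mul_zero] using hrow') (by simpa only [Nat.mul_zero] using hcol') hN₀ hN0 hN00 hNB hD hτ1 hτ2 hψ1 hψ2 hguard q t.1 t.2.1 t.2.2

end Born

end Summit.HubbardSuperconductivity.HubbardSuperconductivity.Theorems.EngineV8

end
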